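/-
Copyright: the b2b-balaban T⁴-continuum CRUX team, row NE7b OWNER lineage `t4-ne7b-p1` (gen 136). Project licence.
-/
import Literature.MathematicalPhysics.QuantumFieldTheory.GaussianToolkit

/-!
# THE DRESSED FLUCTUATION COVARIANCE KEEPS THE ROAD'S THREE GAUSSIAN INPUTS — (α4), THE MARGIN OF THE ABSORPTION STEP: if the fluctuation
# covariance has the road's letters (`S ≻ 0`, `S ⪯ γ·1`) and the extracted quadratic part `K` (the Hessian of the next potential at the
# background, (319)∕(320)) is bounded below, `K ⪰ −k·1` with `kγ < 1`, then the DRESSED precision `S⁻¹ + K` of (385)'s absorbed Gaussian is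
# coercive, `S⁻¹ + K ⪰ (γ⁻¹ − k)·1 ≻ 0`, and the DRESSED covariance `(S⁻¹ + K)⁻¹` has the three inputs every Gaussian letter of the road
# ((288)∕(289)∕(378)) consumes:  `(S⁻¹+K)⁻¹ ⪰ 0`,  `(S⁻¹+K)⁻¹ ⪯ γ⁺·1`,  `(S⁻¹+K)⁻¹(x,x) ≤ γ⁺`  with  `γ⁺ = γ∕(1 − kγ)`;
# a CONVEX extracted part (`K ⪰ 0`) gives `γ⁺ = γ` — dressing never worsens the letters (row NE7b, node U5c; [folklore])

Cell `pub-balaban`, sub-cell `t4`, spine estimate NE7b (`T4WeightBudget.RelWeightBound`; the cell's OWN estimate — NOT PRINTED in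
[Bałaban 1983–89], NOT PROVED).  Crux-route work under `Spine/NE7b/` by the row OWNER (`t4-ne7b-p1` gen 136, file (387)) under FREEZE
(0)'s crux-prover clause, on gen 135's SCOPING-d7 DECISION (d7′)(2′)(iii)∕(c) («the dressed Gaussian `N(0,(Γ⁻¹+K)⁻¹)` for the next step»);
NOTHING of Bałaban's is named as a Lean object, valued or asserted; no `T4Continuum/Support` leaf typed; no `def`, no notation; zero `sorry`.
Imports (BY NAME): the tree's `GaussianToolkit` (`dotProduct_mulVec_sq_le` — Cauchy–Schwarz for a nonnegative form); Mathlib's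
`Matrix.PosDef.inv`, `PosSemidef.of_dotProduct_mulVec_nonneg`, `PosDef.of_dotProduct_mulVec_pos`, `Finset.sum_mul_sq_le_sq_mul_sq`.

WHAT IS PROVED ([folklore]):
* §1 form ⟷ order: `form_le_of_sub_posSemidef` (`c·1 − M ⪰ 0 ⟹ vᵀMv ≤ c(v·v)`), `sub_posSemidef_of_form_le` (converse for symmetric `M`),
  `form_ge_of_add_posSemidef` (`M + k·1 ⪰ 0 ⟹ −k(v·v) ≤ vᵀMv`), `isHermitian_of_add_posSemidef`;
* §2 inverse bounds in form language: `inv_form_le_of_form_ge` (`Q ≻ 0`, `c(v·v) ≤ vᵀQv`, `c > 0` ⟹ `vᵀQ⁻¹v ≤ c⁻¹(v·v)`),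
  `inv_form_ge_of_form_le` (`S ≻ 0`, `vᵀSv ≤ C(v·v)`, `C > 0` ⟹ `C⁻¹(v·v) ≤ vᵀS⁻¹v`);
* §3 **`dressed_precision_coercive`** (`(γ⁻¹ − k)(v·v) ≤ vᵀ(S⁻¹+K)v`), **`dressed_precision_posDef`** (`kγ < 1 ⟹ S⁻¹ + K ≻ 0`);
* §4 THE END **`dressed_covariance_letters`**: `(S⁻¹+K)⁻¹ ⪰ 0`, `(γ∕(1−kγ))·1 − (S⁻¹+K)⁻¹ ⪰ 0`, `(S⁻¹+K)⁻¹(x,x) ≤ γ∕(1−kγ)`;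
  `dressed_covariance_letters_convex` (`K ⪰ 0`: the same three with `γ`); §5 toy.

HONEST (what this is NOT).  Finite-dimensional linear algebra; the road's `K_D` and its lower letter `k` (from the two-sided second-order
class (322) ∕ the Hessian files (319)∕(320)) are INPUTS here, as is the smallness `kγ < 1` (in natural units: the perturbation's Hessian is
small against the fluctuation precision) — NOT discharged; no finite-range ∕ locality letter for the dressed covariance (the dressed column
(233)–(256) on `ℤ^d` is where decay lives); scalar skeleton ((A3), NC-NE7b-α UNRULED); nothing of Bałaban's asserted.  BY-NAME EFFECT ON THE
WALL: NONE.  NE7b NOT PRINTED ∕ NOT PROVED; spine PROVED 0∕9; rung (B)+1 — the programme's measures remain FINITE-torus statements; NOT the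
mass gap, NOT Clay.  HONEST DEPENDENCY: continuum YM on T⁴ ⇐ BetaPertH ∧ nine spine estimates (0∕9 proved); BetaPertH ⇐ (D1) ∧ (D4) ∧
CAP+tail; G-an2-4 gates asym, D1 and NE2∕3∕4.
-/

set_option autoImplicit false

noncomputable section

namespace Summit.QuantumFields.BalabanUV.T4Continuum.NE7b.SupDressedCovarianceLetters

open Matrix Finset
open scoped BigOperators
open Literature.MathematicalPhysics.QuantumFieldTheory.GaussianToolkit (dotProduct_mulVec_sq_le)

variable {ι : Type*} [Fintype ι] [DecidableEq ι]

/-! ## §1. Form ⟷ Loewner order, over `ℝ` -/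

/-- `c·1 − M ⪰ 0 ⟹ vᵀMv ≤ c·(v·v)`. [folklore] -/
theorem form_le_of_sub_posSemidef {M : Matrix ι ι ℝ} {c : ℝ} (h : (c • (1 : Matrix ι ι ℝ) - M).PosSemidef) (v : ι → ℝ) :
    v ⬝ᵥ M *ᵥ v ≤ c * (v ⬝ᵥ v) := by
  have h1 := h.dotProduct_mulVec_nonneg v
  rw [star_trivial, sub_mulVec, dotProduct_sub, smul_mulVec, one_mulVec, dotProduct_smul, smul_eq_mul] at h1
  linarith

/-- `Mᵀ = M` and `vᵀMv ≤ c·(v·v)` for all `v` ⟹ `c·1 − M ⪰ 0`. [folklore] -/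
theorem sub_posSemidef_of_form_le {M : Matrix ι ι ℝ} {c : ℝ} (hM : M.IsHermitian) (h : ∀ v : ι → ℝ, v ⬝ᵥ M *ᵥ v ≤ c * (v ⬝ᵥ v)) :
    (c • (1 : Matrix ι ι ℝ) - M).PosSemidef := by
  refine PosSemidef.of_dotProduct_mulVec_nonneg ?_ fun v => ?_
  · have h1 : (c • (1 : Matrix ι ι ℝ)).IsHermitian := by
      rw [Matrix.IsHermitian, conjTranspose_smul, conjTranspose_one, star_trivial]
    exact h1.sub hM
  · rw [star_trivial, sub_mulVec, dotProduct_sub, smul_mulVec, one_mulVec, dotProduct_smul, smul_eq_mul]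
    have := h v
    linarith

/-- `M + k·1 ⪰ 0 ⟹ −k·(v·v) ≤ vᵀMv`. [folklore] -/
theorem form_ge_of_add_posSemidef {M : Matrix ι ι ℝ} {k : ℝ} (h : (M + k • (1 : Matrix ι ι ℝ)).PosSemidef) (v : ι → ℝ) :
    -k * (v ⬝ᵥ v) ≤ v ⬝ᵥ M *ᵥ v := by
  have h1 := h.dotProduct_mulVec_nonneg v
  rw [star_trivial, add_mulVec, dotProduct_add, smul_mulVec, one_mulVec, dotProduct_smul, smul_eq_mul] at h1
  linarith

omit [Fintype ι] in
/-- `M + k·1 ⪰ 0 ⟹ M` is symmetric. [folklore] -/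
theorem isHermitian_of_add_posSemidef {M : Matrix ι ι ℝ} {k : ℝ} (h : (M + k • (1 : Matrix ι ι ℝ)).PosSemidef) : M.IsHermitian := by
  have h1 : (k • (1 : Matrix ι ι ℝ)).IsHermitian := by
    rw [Matrix.IsHermitian, conjTranspose_smul, conjTranspose_one, star_trivial]
  have h2 := h.isHermitian.sub h1
  rwa [add_sub_cancel_right] at h2

/-! ## §2. Inverse bounds in form language -/

/-- **Upper bound of the inverse from a lower bound**: `Q ≻ 0`, `c > 0`, `c(v·v) ≤ vᵀQv` for all `v` ⟹ `vᵀQ⁻¹v ≤ c⁻¹(v·v)`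
(`w = Q⁻¹v`: `c(w·w) ≤ wᵀQw = w·v ≤ √(w·w)√(v·v)`). [folklore] -/
theorem inv_form_le_of_form_ge {Q : Matrix ι ι ℝ} (hQ : Q.PosDef) {c : ℝ} (hc : 0 < c)
    (hlow : ∀ v : ι → ℝ, c * (v ⬝ᵥ v) ≤ v ⬝ᵥ Q *ᵥ v) (v : ι → ℝ) : v ⬝ᵥ Q⁻¹ *ᵥ v ≤ c⁻¹ * (v ⬝ᵥ v) := by
  have hu := (Matrix.isUnit_iff_isUnit_det _).1 hQ.isUnit
  have hQt : Qᵀ = Q := by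
    have h := hQ.isHermitian; rwa [Matrix.IsHermitian, conjTranspose_eq_transpose_of_trivial] at h
  set w := Q⁻¹ *ᵥ v with hw
  have hv : Q *ᵥ w = v := by rw [hw, mulVec_mulVec, mul_nonsing_inv _ hu, one_mulVec]
  -- `vᵀQ⁻¹v = wᵀQw = w·v`
  have hform : v ⬝ᵥ Q⁻¹ *ᵥ v = w ⬝ᵥ Q *ᵥ w := by
    rw [← hw]
    conv_lhs => rw [← hv, ← vecMul_transpose, hQt, ← dotProduct_mulVec]
  have hwv : w ⬝ᵥ Q *ᵥ w = w ⬝ᵥ v := by rw [hv]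
  have hcs := Finset.sum_mul_sq_le_sq_mul_sq Finset.univ w v
  -- `(w·v)² ≤ (w·w)(v·v)` and `c(w·w) ≤ w·v`
  have h1 : c * (w ⬝ᵥ w) ≤ w ⬝ᵥ v := hwv ▸ hlow w
  have hcs' : (w ⬝ᵥ v) ^ 2 ≤ (w ⬝ᵥ w) * (v ⬝ᵥ v) := by
    simpa only [dotProduct, pow_two] using hcs
  rw [hform, hwv]
  have ha0 : 0 ≤ w ⬝ᵥ v := by rw [← hwv]; have := hQ.posSemidef.dotProduct_mulVec_nonneg w; rwa [star_trivial] at this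
  have hvv : 0 ≤ v ⬝ᵥ v := by have := dotProduct_star_self_nonneg v; rwa [star_trivial] at this
  -- `a := w·v`: `a² ≤ (w·w)(v·v) ≤ (a/c)(v·v)` ⟹ `a ≤ (v·v)/c`
  have h2 : (w ⬝ᵥ v) ^ 2 ≤ (w ⬝ᵥ v) / c * (v ⬝ᵥ v) :=
    hcs'.trans (mul_le_mul_of_nonneg_right (by rw [le_div_iff₀ hc]; linarith) hvv)
  by_cases ha : w ⬝ᵥ v = 0
  · rw [ha]; exact mul_nonneg (inv_nonneg.2 hc.le) hvv
  · have hapos : 0 < w ⬝ᵥ v := lt_of_le_of_ne ha0 (Ne.symm ha)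
    have h3 : w ⬝ᵥ v ≤ (v ⬝ᵥ v) / c := by
      have h2' : (w ⬝ᵥ v) * (w ⬝ᵥ v) ≤ (w ⬝ᵥ v) * ((v ⬝ᵥ v) / c) := by
        calc (w ⬝ᵥ v) * (w ⬝ᵥ v) = (w ⬝ᵥ v) ^ 2 := by ring
          _ ≤ (w ⬝ᵥ v) / c * (v ⬝ᵥ v) := h2
          _ = (w ⬝ᵥ v) * ((v ⬝ᵥ v) / c) := by ring
      exact le_of_mul_le_mul_left h2' hapos
    calc w ⬝ᵥ v ≤ (v ⬝ᵥ v) / c := h3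
      _ = c⁻¹ * (v ⬝ᵥ v) := by rw [div_eq_inv_mul]

/-- **Lower bound of the inverse from an upper bound**: `S ≻ 0`, `C > 0`, `vᵀSv ≤ C(v·v)` for all `v` ⟹ `C⁻¹(v·v) ≤ vᵀS⁻¹v`
(`w = S⁻¹v`: `(v·v)² = (vᵀSw)² ≤ (vᵀSv)(wᵀSw) ≤ C(v·v)·vᵀS⁻¹v`). [folklore] -/
theorem inv_form_ge_of_form_le {S : Matrix ι ι ℝ} (hS : S.PosDef) {C : ℝ} (hC : 0 < C)
    (hup : ∀ v : ι → ℝ, v ⬝ᵥ S *ᵥ v ≤ C * (v ⬝ᵥ v)) (v : ι → ℝ) : C⁻¹ * (v ⬝ᵥ v) ≤ v ⬝ᵥ S⁻¹ *ᵥ v := by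
  have hu := (Matrix.isUnit_iff_isUnit_det _).1 hS.isUnit
  have hSt : Sᵀ = S := by
    have h := hS.isHermitian; rwa [Matrix.IsHermitian, conjTranspose_eq_transpose_of_trivial] at h
  have hnn : ∀ u : ι → ℝ, 0 ≤ u ⬝ᵥ S *ᵥ u := fun u => by
    have := hS.posSemidef.dotProduct_mulVec_nonneg u; rwa [star_trivial] at this
  set w := S⁻¹ *ᵥ v with hw
  have hv : S *ᵥ w = v := by rw [hw, mulVec_mulVec, mul_nonsing_inv _ hu, one_mulVec]
  have hform : v ⬝ᵥ S⁻¹ *ᵥ v = w ⬝ᵥ S *ᵥ w := by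
    rw [← hw]
    conv_lhs => rw [← hv, ← vecMul_transpose, hSt, ← dotProduct_mulVec]
  have hkey : v ⬝ᵥ S *ᵥ w = v ⬝ᵥ v := by rw [hv]
  have hcs := dotProduct_mulVec_sq_le hSt hnn v w
  rw [hkey] at hcs
  rw [hform]
  have hvv : 0 ≤ v ⬝ᵥ v := by have := dotProduct_star_self_nonneg v; rwa [star_trivial] at this
  -- `(v·v)² ≤ (vᵀSv)(wᵀSw) ≤ C(v·v)(wᵀSw)`
  have h3 : (v ⬝ᵥ v) ^ 2 ≤ C * (v ⬝ᵥ v) * (w ⬝ᵥ S *ᵥ w) := by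
    calc (v ⬝ᵥ v) ^ 2 ≤ (v ⬝ᵥ S *ᵥ v) * (w ⬝ᵥ S *ᵥ w) := hcs
      _ ≤ C * (v ⬝ᵥ v) * (w ⬝ᵥ S *ᵥ w) := mul_le_mul_of_nonneg_right (hup v) (hnn w)
  rw [inv_mul_le_iff₀ hC]
  by_cases hv0 : v ⬝ᵥ v = 0
  · rw [hv0]; exact mul_nonneg hC.le (hnn w)
  · have hpos : 0 < v ⬝ᵥ v := lt_of_le_of_ne hvv (Ne.symm hv0)
    refine le_of_mul_le_mul_right ?_ hpos
    nlinarith [h3]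

/-! ## §3. The dressed precision is coercive -/

section Dressed

variable {S K : Matrix ι ι ℝ} {γ k : ℝ}

/-- **THE DRESSED PRECISION IS COERCIVE**: `S ≻ 0`, `γ·1 − S ⪰ 0`, `0 < γ`, `K + k·1 ⪰ 0` ⟹ `(γ⁻¹ − k)(v·v) ≤ vᵀ(S⁻¹ + K)v`. [folklore] -/
theorem dressed_precision_coercive (hS : S.PosDef) (hSγ : (γ • (1 : Matrix ι ι ℝ) - S).PosSemidef) (hγ : 0 < γ)
    (hK : (K + k • (1 : Matrix ι ι ℝ)).PosSemidef) (v : ι → ℝ) :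
    (γ⁻¹ - k) * (v ⬝ᵥ v) ≤ v ⬝ᵥ (S⁻¹ + K) *ᵥ v := by
  have h1 := inv_form_ge_of_form_le hS hγ (form_le_of_sub_posSemidef hSγ) v
  have h2 := form_ge_of_add_posSemidef hK v
  rw [add_mulVec, dotProduct_add]
  linarith

/-- **THE DRESSED PRECISION IS POSITIVE DEFINITE** under `kγ < 1`: `S⁻¹ + K ≻ 0` — (385)'s hypothesis `hQ`. [folklore] -/
theorem dressed_precision_posDef (hS : S.PosDef) (hSγ : (γ • (1 : Matrix ι ι ℝ) - S).PosSemidef) (hγ : 0 < γ)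
    (hK : (K + k • (1 : Matrix ι ι ℝ)).PosSemidef) (hkγ : k * γ < 1) : (S⁻¹ + K).PosDef := by
  have hc : 0 < γ⁻¹ - k := by
    have : γ⁻¹ - k = (1 - k * γ) / γ := by field_simp
    rw [this]; exact div_pos (by linarith) hγ
  refine PosDef.of_dotProduct_mulVec_pos (hS.inv.isHermitian.add (isHermitian_of_add_posSemidef hK)) fun v hv => ?_
  have hvv : 0 < v ⬝ᵥ v := by
    have h := dotProduct_star_self_pos_iff.2 hv
    rwa [star_trivial] at h
  rw [star_trivial]
  exact lt_of_lt_of_le (mul_pos hc hvv) (dressed_precision_coercive hS hSγ hγ hK v)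

/-! ## §4. THE END: the dressed covariance keeps the three Gaussian inputs -/

/-- **THE DRESSED COVARIANCE LETTERS.**  `S ≻ 0`, `γ·1 − S ⪰ 0`, `0 < γ`, `K + k·1 ⪰ 0`, `kγ < 1` (any sign of `k`) ⟹ with `γ⁺ = γ∕(1 − kγ)`:
`(S⁻¹+K)⁻¹ ⪰ 0`, `γ⁺·1 − (S⁻¹+K)⁻¹ ⪰ 0`, `(S⁻¹+K)⁻¹(x,x) ≤ γ⁺` for every `x` — the road's three Gaussian inputs (`hΓ`, `hΓop`, `hdiag`) for
the DRESSED fluctuation covariance of (385). [folklore] -/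
theorem dressed_covariance_letters (hS : S.PosDef) (hSγ : (γ • (1 : Matrix ι ι ℝ) - S).PosSemidef) (hγ : 0 < γ)
    (hK : (K + k • (1 : Matrix ι ι ℝ)).PosSemidef) (hkγ : k * γ < 1) :
    ((S⁻¹ + K)⁻¹).PosSemidef ∧ ((γ / (1 - k * γ)) • (1 : Matrix ι ι ℝ) - (S⁻¹ + K)⁻¹).PosSemidef ∧
      ∀ x : ι, (S⁻¹ + K)⁻¹ x x ≤ γ / (1 - k * γ) := by
  have hQ := dressed_precision_posDef hS hSγ hγ hK hkγ
  have h1γ : 0 < 1 - k * γ := by linarith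
  have hc : 0 < γ⁻¹ - k := by
    have : γ⁻¹ - k = (1 - k * γ) / γ := by field_simp
    rw [this]; exact div_pos h1γ hγ
  have hcinv : (γ⁻¹ - k)⁻¹ = γ / (1 - k * γ) := by
    have : γ⁻¹ - k = (1 - k * γ) / γ := by field_simp
    rw [this, inv_div]
  have hform : ∀ v : ι → ℝ, v ⬝ᵥ (S⁻¹ + K)⁻¹ *ᵥ v ≤ (γ / (1 - k * γ)) * (v ⬝ᵥ v) := fun v => by
    rw [← hcinv]; exact inv_form_le_of_form_ge hQ hc (dressed_precision_coercive hS hSγ hγ hK) v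
  refine ⟨hQ.inv.posSemidef, sub_posSemidef_of_form_le hQ.inv.isHermitian hform, fun x => ?_⟩
  have h := hform (Pi.single x 1)
  rw [Matrix.mulVec_single_one, single_dotProduct, one_mul] at h
  simpa using h

/-- **CONVEX DRESSING NEVER WORSENS THE LETTERS**: `K ⪰ 0` ⟹ `(S⁻¹+K)⁻¹ ⪰ 0`, `γ·1 − (S⁻¹+K)⁻¹ ⪰ 0`, `(S⁻¹+K)⁻¹(x,x) ≤ γ`. [folklore] -/
theorem dressed_covariance_letters_convex (hS : S.PosDef) (hSγ : (γ • (1 : Matrix ι ι ℝ) - S).PosSemidef) (hγ : 0 < γ)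
    (hK : K.PosSemidef) :
    ((S⁻¹ + K)⁻¹).PosSemidef ∧ (γ • (1 : Matrix ι ι ℝ) - (S⁻¹ + K)⁻¹).PosSemidef ∧ ∀ x : ι, (S⁻¹ + K)⁻¹ x x ≤ γ := by
  have hK0 : (K + (0 : ℝ) • (1 : Matrix ι ι ℝ)).PosSemidef := by rwa [zero_smul, add_zero]
  have h := dressed_covariance_letters hS hSγ hγ hK0 (by rw [zero_mul]; exact one_pos)
  simp only [zero_mul, sub_zero, div_one] at h
  exact h

end Dressed

/-! ## §5. Toy -/

/-- Toy (§1): `1·1 − 1 ⪰ 0` gives `vᵀ1v ≤ 1·(v·v)`. -/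
example (v : ι → ℝ) : v ⬝ᵥ (1 : Matrix ι ι ℝ) *ᵥ v ≤ 1 * (v ⬝ᵥ v) :=
  form_le_of_sub_posSemidef (by rw [one_smul, sub_self]; exact PosSemidef.zero) v

end Summit.QuantumFields.BalabanUV.T4Continuum.NE7b.SupDressedCovarianceLetters
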